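import Summits.Ventures.PercRepro.RLSRuleLineFreeTypes
import Summits.Ventures.PercRepro.RLSPlanesT1_1
import Summits.Ventures.PercRepro.RLSPlanesT2_1

/-!
# PercRepro — `R₃⁺` certifies EVERY line-free plane at every `p ≥ 8`: the planes `U_{3,4}`, `U_{3,5}` and the
grand wrapper (night-3, gen 3)

The two line-free planes with `4` or `5` points at the types `t ∈ {1, 2, 3}` close with the lane's landed per-plane
instances (`U1.Planes1.plane1_t1`: `U_{3,4}` at `t = 1`, demand `4`; `U1.Planes1.plane3_t1`: `U_{3,5}` at `t = 1`,
demand `15`; `U2.Planes1.plane3_t2`: `U_{3,5}` at `t = 2`, demand `10`) or have no bottom set at all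
(`demandCount_eq_zero`: `U_{3,4}` at `t ≥ 2`, `U_{3,5}` at `t = 3`):

* `demandCount_eq_zero`, `demandCount_four_one`, `demandCount_five_one`, `demandCount_five_two`;
* `sum_powerset_lbShare_small`: the supply grouped by size for `|G| ≤ 5`;
* `perFlat_of_demandCount_zero`, `perFlat_lineFree_four_one`, `perFlat_lineFree_five_one`, `perFlat_lineFree_five_two`;
* `perFlat_lineFree_of_card_le_five`: every line-free plane with `4` or `5` points, every `p ≥ 8`;
* **`perFlat_lineFree`** — THE FAMILY: every line-free plane `G` of every finite matroid satisfies the per-flat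
  inequality of `R₃⁺` at `(p, 3)` for every `p ≥ 8`, whatever its size and the rank of its complement.
Imports `RLSRuleLineFreeTypes`, `RLSPlanesT1_1`, `RLSPlanesT2_1`.  Axioms: standard.
-/

open scoped Matroid

namespace PercRepro

namespace NightThree

open Finset ThmH PerFlat

variable {α : Type*} [DecidableEq α] {M : Matroid α} [M.Finite]

/-! ### Small demand counts -/

/-- No bottom set when `|G| < 3 + t`. -/
theorem demandCount_eq_zero {g t : ℕ} (h : g < 3 + t) : demandCount g t = 0 := by
  unfold demandCount
  apply Finset.sum_eq_zero
  intro b _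
  rw [if_neg (by omega), mul_zero]

/-- `demandCount 4 1 = 4`. -/
theorem demandCount_four_one : demandCount 4 1 = 4 := by
  rw [demandCount_eq (by norm_num)]
  simp
  norm_num [Nat.choose]

/-- `demandCount 5 1 = 15`. -/
theorem demandCount_five_one : demandCount 5 1 = 15 := by
  rw [demandCount_eq (by norm_num)]
  simp
  norm_num [Nat.choose]

/-- `demandCount 5 2 = 10`. -/
theorem demandCount_five_two : demandCount 5 2 = 10 := by
  rw [demandCount_eq (by norm_num)]
  simp [Finset.sum_range_succ]
  norm_num [Nat.choose]

/-! ### The supply grouped by size, `|G| ≤ 5` -/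

/-- The supply sum grouped by the size of `B′` for `|G| ≤ 5` (no subset reaches the winner share). -/
theorem sum_powerset_lbShare_small {g : ℕ} (hg : g ≤ 5) (k n : ℕ) :
    ∑ b ∈ range (g + 1), (g.choose b : ℚ) * (∑ i ∈ range n, (k.choose (i + 1) : ℚ) * lbShare b (i + 1)) =
      (g.choose 3 : ℚ) * (∑ i ∈ range n, (k.choose (i + 1) : ℚ) / ((i + 4).choose 3 : ℚ)) +
        4 * (g.choose 4 : ℚ) * (∑ i ∈ range n, (k.choose (i + 1) : ℚ) / ((i + 5).choose 3 : ℚ)) +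
        10 * (g.choose 5 : ℚ) * (∑ i ∈ range n, (k.choose (i + 1) : ℚ) / ((i + 6).choose 3 : ℚ)) := by
  -- extend the sum to `range 6`: the extra binomials vanish
  have hext : ∑ b ∈ range (g + 1), (g.choose b : ℚ) * (∑ i ∈ range n, (k.choose (i + 1) : ℚ) * lbShare b (i + 1)) =
      ∑ b ∈ range 6, (g.choose b : ℚ) * (∑ i ∈ range n, (k.choose (i + 1) : ℚ) * lbShare b (i + 1)) := by
    rw [← Finset.sum_range_add_sum_Ico _ (show g + 1 ≤ 6 by omega)]
    have hz : ∑ b ∈ Finset.Ico (g + 1) 6, (g.choose b : ℚ) *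
        (∑ i ∈ range n, (k.choose (i + 1) : ℚ) * lbShare b (i + 1)) = 0 := by
      apply Finset.sum_eq_zero
      intro b hb
      rw [Finset.mem_Ico] at hb
      rw [Nat.choose_eq_zero_of_lt (by omega), Nat.cast_zero, zero_mul]
    rw [hz, add_zero]
  rw [hext]
  have h0 : ∀ b ≤ 2, (∑ i ∈ range n, (k.choose (i + 1) : ℚ) * lbShare b (i + 1)) = 0 := by
    intro b hb
    apply Finset.sum_eq_zero
    intro i _
    rw [lbShare_of_le_two hb, mul_zero]
  have h3 : (∑ i ∈ range n, (k.choose (i + 1) : ℚ) * lbShare 3 (i + 1)) =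
      ∑ i ∈ range n, (k.choose (i + 1) : ℚ) / ((i + 4).choose 3 : ℚ) := by
    apply Finset.sum_congr rfl
    intro i _
    rw [lbShare_three, show i + 1 + 3 = i + 4 by omega, mul_one_div]
  have h4 : (∑ i ∈ range n, (k.choose (i + 1) : ℚ) * lbShare 4 (i + 1)) =
      4 * ∑ i ∈ range n, (k.choose (i + 1) : ℚ) / ((i + 5).choose 3 : ℚ) := by
    rw [Finset.mul_sum]
    apply Finset.sum_congr rfl
    intro i _
    rw [lbShare_four, show i + 1 + 4 = i + 5 by omega]
    ring
  have h5 : (∑ i ∈ range n, (k.choose (i + 1) : ℚ) * lbShare 5 (i + 1)) =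
      10 * ∑ i ∈ range n, (k.choose (i + 1) : ℚ) / ((i + 6).choose 3 : ℚ) := by
    rw [Finset.mul_sum]
    apply Finset.sum_congr rfl
    intro i _
    rw [lbShare_five, show i + 1 + 5 = i + 6 by omega]
    ring
  simp only [Finset.sum_range_succ, Finset.range_zero, Finset.sum_empty]
  rw [h0 0 (by norm_num), h0 1 (by norm_num), h0 2 (by norm_num), h3, h4, h5]
  ring

/-- The supply bound grouped by size for a line-free plane with `≤ 5` points and `|K| = ρ(E ∖ G) = k`. -/
theorem supply_ge_grouped_small {G : Finset α} (hG : G ∈ flatsQ M 3) (hfree : LineFree M G) (hg : G.card ≤ 5)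
    {k n : ℕ} (he : M.eRk ((gr M \ G : Finset α) : Set α) = k) :
    (G.card.choose 3 : ℚ) * (∑ i ∈ range n, (k.choose (i + 1) : ℚ) / ((i + 4).choose 3 : ℚ)) +
        4 * (G.card.choose 4 : ℚ) * (∑ i ∈ range n, (k.choose (i + 1) : ℚ) / ((i + 5).choose 3 : ℚ)) +
        10 * (G.card.choose 5 : ℚ) * (∑ i ∈ range n, (k.choose (i + 1) : ℚ) / ((i + 6).choose 3 : ℚ)) ≤
      ∑ S ∈ Yq M (n + 4) 3, wPlus M G S := by
  obtain ⟨K, hKsub, hKind, hKcard⟩ := exists_indep_compl G he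
  have hsup := supply_ge_of_lineFree hG hfree hKsub hKind n
  rw [Finset.sum_powerset_apply_card (fun b => ∑ i ∈ range n, (K.card.choose (i + 1) : ℚ) * lbShare b (i + 1))]
    at hsup
  simp only [nsmul_eq_mul] at hsup
  rw [sum_powerset_lbShare_small hg, hKcard] at hsup
  exact hsup

/-! ### The instances -/

/-- When the demand count vanishes the inequality is trivial. -/
theorem perFlat_of_demandCount_zero {G : Finset α} {p t e : ℕ}
    (he : M.eRk ((gr M \ G : Finset α) : Set α) = e) (het : e + t ≤ p) (h0 : demandCount G.card t = 0) :
    phiK p 3 * ((UqG M p 3 G).card : ℚ) ≤ ∑ S ∈ Yq M p 3, wPlus M G S := by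
  have hdem := card_UqG_le_of_eRk_compl G he het
  rw [h0] at hdem
  have hzero : ((UqG M p 3 G).card : ℚ) = 0 := le_antisymm hdem (by positivity)
  rw [hzero, mul_zero]
  exact Finset.sum_nonneg (fun S _ => wPlus_nonneg M G S)

/-- `U_{3,4}` at type `1`, `p ≥ 8` (`U1.Planes1.plane1_t1`). -/
theorem perFlat_lineFree_four_one {G : Finset α} (hG : G ∈ flatsQ M 3) (hfree : LineFree M G)
    (hg : G.card = 4) {n : ℕ} (hn : 4 ≤ n) (he : M.eRk ((gr M \ G : Finset α) : Set α) = ((n + 3 : ℕ) : ℕ∞)) :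
    phiK (n + 4) 3 * ((UqG M (n + 4) 3 G).card : ℚ) ≤ ∑ S ∈ Yq M (n + 4) 3, wPlus M G S := by
  have hdem := card_UqG_le_of_eRk_compl G he (show n + 3 + 1 ≤ n + 4 by omega)
  rw [hg, demandCount_four_one] at hdem
  have hsup := supply_ge_grouped_small hG hfree (by omega) (n := n) he
  rw [hg] at hsup
  have hfam := U1.Planes1.plane1_t1 n hn
  unfold U1.q0Sum U1.q1Sum at hfam
  rw [← phiK_eq_sum] at hfam
  calc phiK (n + 4) 3 * ((UqG M (n + 4) 3 G).card : ℚ)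
      ≤ phiK (n + 4) 3 * 4 := mul_le_mul_of_nonneg_left hdem (phiK_nonneg _ _)
    _ ≤ 4 * (∑ i ∈ range n, ((n + 3).choose (i + 1) : ℚ) / ((i + 4).choose 3 : ℚ)) +
          4 * (∑ i ∈ range n, ((n + 3).choose (i + 1) : ℚ) / ((i + 5).choose 3 : ℚ)) := hfam
    _ ≤ ∑ S ∈ Yq M (n + 4) 3, wPlus M G S := by
        have h43 : ((4 : ℕ).choose 3 : ℚ) = 4 := by norm_num [Nat.choose]
        have h44 : ((4 : ℕ).choose 4 : ℚ) = 1 := by norm_num [Nat.choose]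
        have h45 : ((4 : ℕ).choose 5 : ℚ) = 0 := by norm_num [Nat.choose]
        rw [h43, h44, h45] at hsup
        linarith

/-- `U_{3,5}` at type `1`, `p ≥ 8` (`U1.Planes1.plane3_t1`). -/
theorem perFlat_lineFree_five_one {G : Finset α} (hG : G ∈ flatsQ M 3) (hfree : LineFree M G)
    (hg : G.card = 5) {n : ℕ} (hn : 4 ≤ n) (he : M.eRk ((gr M \ G : Finset α) : Set α) = ((n + 3 : ℕ) : ℕ∞)) :
    phiK (n + 4) 3 * ((UqG M (n + 4) 3 G).card : ℚ) ≤ ∑ S ∈ Yq M (n + 4) 3, wPlus M G S := by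
  have hdem := card_UqG_le_of_eRk_compl G he (show n + 3 + 1 ≤ n + 4 by omega)
  rw [hg, demandCount_five_one] at hdem
  have hsup := supply_ge_grouped_small hG hfree (by omega) (n := n) he
  rw [hg] at hsup
  have hfam := U1.Planes1.plane3_t1 n hn
  unfold U1.q0Sum U1.q1Sum U1.q2Sum at hfam
  rw [← phiK_eq_sum] at hfam
  calc phiK (n + 4) 3 * ((UqG M (n + 4) 3 G).card : ℚ)
      ≤ phiK (n + 4) 3 * 15 := mul_le_mul_of_nonneg_left hdem (phiK_nonneg _ _)
    _ ≤ 10 * (∑ i ∈ range n, ((n + 3).choose (i + 1) : ℚ) / ((i + 4).choose 3 : ℚ)) +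
          20 * (∑ i ∈ range n, ((n + 3).choose (i + 1) : ℚ) / ((i + 5).choose 3 : ℚ)) +
          10 * (∑ i ∈ range n, ((n + 3).choose (i + 1) : ℚ) / ((i + 6).choose 3 : ℚ)) := hfam
    _ ≤ ∑ S ∈ Yq M (n + 4) 3, wPlus M G S := by
        have h53 : ((5 : ℕ).choose 3 : ℚ) = 10 := by norm_num [Nat.choose]
        have h54 : ((5 : ℕ).choose 4 : ℚ) = 5 := by norm_num [Nat.choose]
        have h55 : ((5 : ℕ).choose 5 : ℚ) = 1 := by norm_num [Nat.choose]
        rw [h53, h54, h55] at hsup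
        linarith

/-- `U_{3,5}` at type `2`, `p ≥ 8` (`U2.Planes1.plane3_t2`). -/
theorem perFlat_lineFree_five_two {G : Finset α} (hG : G ∈ flatsQ M 3) (hfree : LineFree M G)
    (hg : G.card = 5) {n : ℕ} (hn : 4 ≤ n) (he : M.eRk ((gr M \ G : Finset α) : Set α) = ((n + 2 : ℕ) : ℕ∞)) :
    phiK (n + 4) 3 * ((UqG M (n + 4) 3 G).card : ℚ) ≤ ∑ S ∈ Yq M (n + 4) 3, wPlus M G S := by
  have hdem := card_UqG_le_of_eRk_compl G he (show n + 2 + 2 ≤ n + 4 by omega)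
  rw [hg, demandCount_five_two] at hdem
  have hsup := supply_ge_grouped_small hG hfree (by omega) (n := n) he
  rw [hg] at hsup
  have hfam := U2.Planes1.plane3_t2 n hn
  unfold U2.r0Sum U2.r1Sum U2.r2Sum at hfam
  rw [← phiK_eq_sum] at hfam
  calc phiK (n + 4) 3 * ((UqG M (n + 4) 3 G).card : ℚ)
      ≤ phiK (n + 4) 3 * 10 := mul_le_mul_of_nonneg_left hdem (phiK_nonneg _ _)
    _ ≤ 10 * (∑ i ∈ range n, ((n + 2).choose (i + 1) : ℚ) / ((i + 4).choose 3 : ℚ)) +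
          20 * (∑ i ∈ range n, ((n + 2).choose (i + 1) : ℚ) / ((i + 5).choose 3 : ℚ)) +
          10 * (∑ i ∈ range n, ((n + 2).choose (i + 1) : ℚ) / ((i + 6).choose 3 : ℚ)) := hfam
    _ ≤ ∑ S ∈ Yq M (n + 4) 3, wPlus M G S := by
        have h53 : ((5 : ℕ).choose 3 : ℚ) = 10 := by norm_num [Nat.choose]
        have h54 : ((5 : ℕ).choose 4 : ℚ) = 5 := by norm_num [Nat.choose]
        have h55 : ((5 : ℕ).choose 5 : ℚ) = 1 := by norm_num [Nat.choose]
        rw [h53, h54, h55] at hsup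
        linarith

/-- **Every line-free plane with `4` or `5` points at every `p ≥ 8`.** -/
theorem perFlat_lineFree_of_card_le_five {G : Finset α} (hG : G ∈ flatsQ M 3) (hfree : LineFree M G)
    (hg4 : 4 ≤ G.card) (hg5 : G.card ≤ 5) {p : ℕ} (hp : 8 ≤ p) :
    phiK p 3 * ((UqG M p 3 G).card : ℚ) ≤ ∑ S ∈ Yq M p 3, wPlus M G S := by
  obtain ⟨n, rfl⟩ : ∃ n, p = n + 4 := ⟨p - 4, by omega⟩
  have hn : 4 ≤ n := by omega
  obtain ⟨e, he, _⟩ := eRk_eq_nat M (gr M \ G)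
  rcases le_or_gt (n + 4) e with h0 | h0
  · exact perFlat_lineFree_of_typeZero hG hfree (n + 4) (by rw [he]; exact_mod_cast h0)
  rcases lt_or_ge (e + 3) (n + 4) with hlt | hge
  · rw [UqG_eq_empty_of_eRk_compl_lt hG he hlt, Finset.card_empty, Nat.cast_zero, mul_zero]
    exact Finset.sum_nonneg (fun S _ => wPlus_nonneg M G S)
  rcases (show G.card = 4 ∨ G.card = 5 by omega) with hg | hg
  · rcases (show e = n + 1 ∨ e = n + 2 ∨ e = n + 3 by omega) with h | h | h
    · exact perFlat_of_demandCount_zero (t := 3) he (by omega) (by rw [hg]; exact demandCount_eq_zero (by norm_num))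
    · exact perFlat_of_demandCount_zero (t := 2) he (by omega) (by rw [hg]; exact demandCount_eq_zero (by norm_num))
    · exact perFlat_lineFree_four_one hG hfree hg hn (by rw [he, h])
  · rcases (show e = n + 1 ∨ e = n + 2 ∨ e = n + 3 by omega) with h | h | h
    · exact perFlat_of_demandCount_zero (t := 3) he (by omega) (by rw [hg]; exact demandCount_eq_zero (by norm_num))
    · exact perFlat_lineFree_five_two hG hfree hg hn (by rw [he, h])
    · exact perFlat_lineFree_five_one hG hfree hg hn (by rw [he, h])

/-- **THE LINE-FREE FAMILY.**  Every line-free plane `G` of every finite matroid satisfies the per-flat inequality of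
`R₃⁺` at `(p, 3)` for every `p ≥ 8`: `Φ(p, 3) · #U_G ≤ Σ_{S ∈ Yq} w⁺(G, S)`. -/
theorem perFlat_lineFree {G : Finset α} (hG : G ∈ flatsQ M 3) (hfree : LineFree M G) {p : ℕ} (hp : 8 ≤ p) :
    phiK p 3 * ((UqG M p 3 G).card : ℚ) ≤ ∑ S ∈ Yq M p 3, wPlus M G S := by
  have hg3 : 3 ≤ G.card := three_le_card_of_eRk_eq_three (eRk_eq_three_of_mem_flatsQ' hG)
  rcases (show G.card = 3 ∨ (4 ≤ G.card ∧ G.card ≤ 5) ∨ 6 ≤ G.card by omega) with h | ⟨h4, h5⟩ | h6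
  · exact perFlat_three_point hG h p
  · exact perFlat_lineFree_of_card_le_five hG hfree h4 h5 hp
  · exact perFlat_lineFree_of_six_le hG hfree h6 hp

end NightThree

end PercRepro
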